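import Summits.HodgeConjecture.HodgeConjecture.Theorems.PadicSemiregularLiftHodgeFermatVarietiesPairedOfLargePrimesDichotomy
import Summits.HodgeConjecture.HodgeConjecture.Theorems.PadicSemiregularLiftHodgeFermatVarietiesPairedOfLargePrimesSharpEven
import Summits.HodgeConjecture.HodgeConjecture.Theorems.PadicSemiregularLiftHodgeFermatVarietiesPairedOfLargePrimes
import HarnessLib

/-!
# Hodge characters of `Xⁿₘ` are paired when every prime factor of `m` exceeds `n + 1` (sharp)

Crux `HodgeFermatVarieties` (stmt-HodgeConjecture-1334), line `cancel-by-any-claim-lattice`, stub S6 (lead c2),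
SHARP form `isPaired_of_primeFactors_gt_sharp`: a Hodge character `α : Fin R → ℤ/m` with `R < p` for every prime
`p ∣ m` is paired — for `R = n + 2` the `𝔅ⁿₘ = 𝔇ⁿₘ` direction of Aoki's Theorem A under its printed hypothesis
`p > n + 1`. The level induction is that of `level_count_even`; the refined counting `even_of_oddNull'` leaves
only `R = p₀ - 1` distinct points at a level `p₀ n` exactly divisible by the least prime `p₀ = R + 1`; there
`even_of_oddNull_prime` (`n = 1`) or the dichotomy `even_or_fibre_of_boundary` (`n > 1`) plus Aoki's criterion
at `f = n` (`χ(p₀) = 1` for all odd primitive `χ` mod `n` is impossible) conclude. Everything is proved.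
References: [Aoki1983] N. Aoki, Math. Ann. 266 (1983) 23–54, Thm. A, Prop. 2.2, 6.1, 6.4, §9.
-/

set_option linter.dupNamespace false

noncomputable section

open Finset
open Literature.AlgebraicGeometry.HodgeTheory Literature.AlgebraicGeometry.HodgeTheory.FermatCharacter

namespace Summit.HodgeConjecture.HodgeConjecture.Theorems.CancelByAnyClaimLattice

namespace PairedNull

section Sharp

variable {R : ℕ} {m : ℕ} [NeZero m] {α : Fin R → ZMod m}

/-- **The level-`M` multiplicities are even, sharp form** (`R ≥ 4`, `R < p` for all primes `p ∣ m`).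
[cite: Aoki1983, Thm. A] -/
theorem level_count_even_sharp (h : IsHodge α) (hR4 : 4 ≤ R) (hR : ∀ p ∈ m.primeFactors, R < p) :
    ∀ (d M : ℕ), M ∣ m → m / M = d → ∀ v : ZMod M,
      #(univ.filter fun i : Fin R ↦ m / m.gcd (α i).val = M ∧ ((((α i).val / (m / M)) : ℕ) : ZMod M) = -v) =
      #(univ.filter fun i : Fin R ↦ m / m.gcd (α i).val = M ∧ ((((α i).val / (m / M)) : ℕ) : ZMod M) = v) := by
  classical
  intro d
  induction d using Nat.strong_induction_on with
  | _ d ih =>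
  intro M hMm hdM v
  have hm0 : m ≠ 0 := NeZero.ne m
  have hM0 : M ≠ 0 := fun h0 ↦ hm0 (by rw [h0] at hMm; exact zero_dvd_iff.mp hMm)
  haveI : NeZero M := ⟨hM0⟩
  have hIH : ∀ M' : ℕ, M' ∣ m → M ∣ M' → M' ≠ M → ∀ u : ZMod M',
      #(univ.filter fun i : Fin R ↦ m / m.gcd (α i).val = M' ∧ ((((α i).val / (m / M')) : ℕ) : ZMod M') = -u) =
      #(univ.filter fun i : Fin R ↦ m / m.gcd (α i).val = M' ∧ ((((α i).val / (m / M')) : ℕ) : ZMod M') = u) := by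
    intro M' hM'm hMM' hne u
    have hM'0 : M' ≠ 0 := fun h0 ↦ hm0 (by rw [h0] at hM'm; exact zero_dvd_iff.mp hM'm)
    obtain ⟨t, rfl⟩ := hMM'
    obtain ⟨s, hs⟩ := hM'm
    have ht0 : t ≠ 0 := fun h0 ↦ hM'0 (by rw [h0, mul_zero])
    have ht1 : t ≠ 1 := fun h1 ↦ hne (by rw [h1, mul_one])
    have hs0 : 0 < s := Nat.pos_of_ne_zero fun h0 ↦ hm0 (by rw [hs, h0, mul_zero])
    have hlt : m / (M * t) < d := by
      have h1 : m / (M * t) = s := by rw [hs, Nat.mul_div_cancel_left _ (Nat.pos_of_ne_zero hM'0)]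
      have h2 : d = t * s := by
        rw [← hdM, hs, mul_assoc, Nat.mul_div_cancel_left _ (Nat.pos_of_ne_zero hM0)]
      rw [h1, h2]
      calc s = 1 * s := (one_mul s).symm
        _ < t * s := Nat.mul_lt_mul_of_lt_of_le (by omega) (le_refl s) hs0
    exact ih _ hlt (M * t) ⟨s, hs⟩ rfl u
  set cnt : ZMod M → ℕ := fun u ↦
    #(univ.filter fun i : Fin R ↦ m / m.gcd (α i).val = M ∧ ((((α i).val / (m / M)) : ℕ) : ZMod M) = u) with hcnt
  set T : ZMod M → ℂ := fun u ↦ (cnt u : ℂ) with hT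
  change cnt (-v) = cnt v
  have hspec : ∀ i, IsUnit ((((α i).val / (m / (m / m.gcd (α i).val)) : ℕ) : ZMod (m / m.gcd (α i).val))) ∧
      ((m / (m / m.gcd (α i).val) : ℕ) : ZMod m) *
        ((ZMod.val ((((α i).val / (m / (m / m.gcd (α i).val)) : ℕ) : ZMod (m / m.gcd (α i).val))) : ℕ) : ZMod m)
          = α i :=
    fun i ↦ unitPart_spec (α i)
  have hcastM : ∀ (L : ℕ) (_ : L = M) (y : ZMod m),
      (ZMod.cast ((((y.val / (m / L)) : ℕ) : ZMod L)) : ZMod M) = (((y.val / (m / M)) : ℕ) : ZMod M) := by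
    intro L hL y; subst hL; exact ZMod.cast_id _ _
  have hcast : ∀ (L M' : ℕ) (_ : L = M') (hMM' : M ∣ M') (y : ZMod m),
      (ZMod.cast ((((y.val / (m / L)) : ℕ) : ZMod L)) : ZMod M) =
        ZMod.castHom hMM' (ZMod M) ((((y.val / (m / M')) : ℕ) : ZMod M')) := by
    intro L M' hL hMM' y; subst hL; rfl
  have hTu : ∀ u, ¬ IsUnit u → T u = 0 := by
    intro u hu
    simp only [hT, Nat.cast_eq_zero, hcnt, Finset.card_eq_zero, Finset.filter_eq_empty_iff]
    intro i _ hi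
    apply hu
    have hdvd : M ∣ m / m.gcd (α i).val := by rw [hi.1]
    rw [← hi.2, ← hcastM _ hi.1 (α i)]
    exact ((hspec i).1).map (ZMod.castHom hdvd (ZMod M))
  set I : Finset (Fin R) := univ.filter fun i : Fin R ↦ m / m.gcd (α i).val = M with hI
  have hsupp_img : (univ.filter fun u : ZMod M ↦ T u ≠ 0) =
      I.image fun i ↦ ((((α i).val / (m / M)) : ℕ) : ZMod M) := by
    ext u
    rw [mem_filter, mem_image]
    simp only [mem_univ, true_and, hT, Nat.cast_ne_zero, hcnt]
    rw [Finset.card_ne_zero]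
    constructor
    · rintro ⟨i, hi⟩
      rw [mem_filter] at hi
      exact ⟨i, by rw [hI, mem_filter]; exact ⟨mem_univ _, hi.2.1⟩, hi.2.2⟩
    · rintro ⟨i, hi, hiu⟩
      rw [hI, mem_filter] at hi
      exact ⟨i, by rw [mem_filter]; exact ⟨mem_univ _, hi.2, hiu⟩⟩
  have hsuppR : #(univ.filter fun u : ZMod M ↦ T u ≠ 0) ≤ R := by
    rw [hsupp_img]
    exact card_image_le.trans ((card_le_univ I).trans (by rw [Fintype.card_fin]))
  have hM5 : ∀ p ∈ M.primeFactors, 5 ≤ p := by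
    intro p hp
    have hpm : p ∈ m.primeFactors := Nat.mem_primeFactors.mpr ⟨Nat.prime_of_mem_primeFactors hp,
      dvd_trans (Nat.dvd_of_mem_primeFactors hp) hMm, hm0⟩
    have := hR p hpm
    omega
  haveI : ∀ i, NeZero (m / m.gcd (α i).val) := fun i ↦ ⟨(level_pos (α i)).ne'⟩
  have hTodd : ∀ χ : DirichletCharacter ℂ M, χ.Odd → χ.IsPrimitive → ∑ u : ZMod M, T u * χ u = 0 := by
    intro χ hχ hprim
    have key := h.aoki_criterion hMm hχ hprim (fun i ↦ m / m.gcd (α i).val) (fun i ↦ level_dvd (α i))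
      (fun i ↦ ((((α i).val / (m / (m / m.gcd (α i).val)) : ℕ) : ZMod (m / m.gcd (α i).val))))
      (fun i ↦ (hspec i).1) (fun i ↦ (hspec i).2.symm)
    have hone : (∏ p ∈ M.primeFactors, (1 - χ p)) = 1 := by
      refine Finset.prod_eq_one fun p hp ↦ ?_
      have hnu : ¬ IsUnit ((p : ℕ) : ZMod M) := by
        rw [ZMod.isUnit_iff_coprime]
        exact fun hc ↦ (Nat.prime_of_mem_primeFactors hp).one_lt.ne'
          (Nat.Coprime.eq_one_of_dvd hc (Nat.dvd_of_mem_primeFactors hp))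
      rw [χ.map_nonunit hnu, sub_zero]
    have hA : (fun L : ℕ ↦ ((m.totient : ℂ) / (L.totient : ℂ)) * ∏ p ∈ L.primeFactors, (1 - χ p)) M ≠ 0 := by
      show ((m.totient : ℂ) / (M.totient : ℂ)) * ∏ p ∈ M.primeFactors, (1 - χ p) ≠ 0
      rw [hone, mul_one]
      exact div_ne_zero (by exact_mod_cast (Nat.totient_pos.mpr (NeZero.pos m)).ne')
        (by exact_mod_cast (Nat.totient_pos.mpr (NeZero.pos M)).ne')
    have key' := sum_level_eq_zero_of_criterion χ hχ (fun i ↦ m / m.gcd (α i).val)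
      (fun i ↦ (level_pos (α i)).ne')
      (fun i ↦ ((((α i).val / (m / (m / m.gcd (α i).val)) : ℕ) : ZMod (m / m.gcd (α i).val))))
      (fun L : ℕ ↦ ((m.totient : ℂ) / (L.totient : ℂ)) * ∏ p ∈ L.primeFactors, (1 - χ p)) hA key
      (fun i ↦ ((((α i).val / (m / M)) : ℕ) : ZMod M)) (fun i hi ↦ hcastM _ hi (α i))
      (fun L i ↦ ((((α i).val / (m / L)) : ℕ) : ZMod L)) (fun L hML i hiL ↦ hcast _ L hiL hML (α i))
      (fun L ⟨i, hiL⟩ hML hLM u ↦ hIH L (hiL ▸ level_dvd (α i)) hML hLM u)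
    rw [sum_comp_eq_sum_card_mul (univ.filter fun i : Fin R ↦ m / m.gcd (α i).val = M)
      (fun i ↦ ((((α i).val / (m / M)) : ℕ) : ZMod M)) (fun u ↦ (χ u)⁻¹)] at key'
    simp only [Finset.filter_filter] at key'
    have hconj : starRingEnd ℂ (∑ u : ZMod M, T u * χ u) = 0 := by
      rw [map_sum, ← key']
      refine Finset.sum_congr rfl fun u _ ↦ ?_
      rw [map_mul, hT, Complex.conj_natCast, char_inv_eq_conj]
    have := congrArg (starRingEnd ℂ) hconj
    rwa [starRingEnd_self_apply, map_zero] at this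
  by_cases hgood : ∀ p ∈ M.primeFactors, #(univ.filter fun u : ZMod M ↦ T u ≠ 0) + 1 < p ∨
      (p = M.minFac ∧ p * p ∣ M ∧ #(univ.filter fun u : ZMod M ↦ T u ≠ 0) < p)
  · have heven := even_of_oddNull' hM5 T hTu hTodd hgood v
    simp only [hT, Nat.cast_inj] at heven
    exact heven
  -- (v) the boundary case: `#supp T = R = p₀ - 1`, `p₀ ∥ M` the least prime
  push Not at hgood
  obtain ⟨p₀, hp₀mem, hle, hnsq⟩ := hgood
  have hp₀ : p₀.Prime := Nat.prime_of_mem_primeFactors hp₀mem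
  have hp₀M : p₀ ∣ M := Nat.dvd_of_mem_primeFactors hp₀mem
  have hp₀m : p₀ ∈ m.primeFactors := Nat.mem_primeFactors.mpr ⟨hp₀, hp₀M.trans hMm, hm0⟩
  have hRp₀ : R < p₀ := hR p₀ hp₀m
  have hSR : #(univ.filter fun u : ZMod M ↦ T u ≠ 0) = R := by omega
  have hp₀R : p₀ = R + 1 := by omega
  have hmin : p₀ = M.minFac := by
    have h1 : M.minFac ≤ p₀ := Nat.minFac_le_of_dvd hp₀.two_le hp₀M
    have hM1 : M ≠ 1 := fun h1' ↦ by rw [h1'] at hp₀M; exact hp₀.one_lt.ne' (Nat.dvd_one.mp hp₀M)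
    have h2 : M.minFac ∈ m.primeFactors := Nat.mem_primeFactors.mpr
      ⟨Nat.minFac_prime hM1, (Nat.minFac_dvd M).trans hMm, hm0⟩
    have h3 := hR _ h2
    omega
  have hsq : ¬ p₀ * p₀ ∣ M := fun hsq ↦ by have := hnsq hmin hsq; omega
  -- `M = p₀ * n`, `p₀ ∤ n`
  obtain ⟨n, rfl⟩ := hp₀M
  have hn0 : n ≠ 0 := fun h0 ↦ hM0 (by rw [h0, mul_zero])
  haveI : NeZero n := ⟨hn0⟩
  haveI : NeZero p₀ := ⟨hp₀.ne_zero⟩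
  have hp₀n : ¬ p₀ ∣ n := fun hd ↦ hsq (mul_dvd_mul_left p₀ hd)
  have hp₀5 : 5 ≤ p₀ := by omega
  by_cases hn1 : n = 1
  · have hprime : (p₀ * n).Prime := by rw [hn1, mul_one]; exact hp₀
    have heven := even_of_oddNull_prime hprime T hTu hTodd v
    simp only [hT, Nat.cast_inj] at heven
    exact heven
  -- `n > 1`: every prime of `n` is `≥ p₀ + 2`
  have hnbig : ∀ p' ∈ n.primeFactors, p₀ + 1 < p' := by
    intro p' hp'
    have hp'P : p'.Prime := Nat.prime_of_mem_primeFactors hp'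
    have hp'm : p' ∈ m.primeFactors := Nat.mem_primeFactors.mpr ⟨hp'P,
      ((Nat.dvd_of_mem_primeFactors hp').trans (dvd_mul_left n p₀)).trans hMm, hm0⟩
    have h1 : R < p' := hR p' hp'm
    have hne : p' ≠ p₀ := fun he ↦ hp₀n (he ▸ Nat.dvd_of_mem_primeFactors hp')
    -- `p'` is odd (`≥ 5`) and `p' ≠ p₀ = R + 1`, `p' > R`; `R + 2` is even? use parity of `p₀`, `p'`
    have hp'5 : 5 ≤ p' := hM5 p' (by
      rw [Nat.primeFactors_mul hp₀.ne_zero hn0]; exact mem_union_right _ hp')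
    have hp'odd : Odd p' := hp'P.odd_of_ne_two (by omega)
    have hp₀odd : Odd p₀ := hp₀.odd_of_ne_two (by omega)
    rcases hp'odd with ⟨a, ha⟩
    rcases hp₀odd with ⟨b, hb⟩
    omega
  have hn5 : ∀ p' ∈ n.primeFactors, 5 ≤ p' := fun p' hp' ↦ by have := hnbig p' hp'; omega
  have hroom : ∀ p' ∈ n.primeFactors, #(univ.filter fun u : ZMod (p₀ * n) ↦ T u ≠ 0) + 1 < p' := by
    intro p' hp'; have := hnbig p' hp'; omega
  have hc : p₀.Coprime n := hp₀.coprime_iff_not_dvd.mpr hp₀n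
  -- `T` takes only the values `0, 1` (there are `R` support points and at most `R` level-`M` indices)
  have h01 : ∀ u, T u = 0 ∨ T u = 1 := by
    have hsum : ∑ u ∈ univ.filter (fun u : ZMod (p₀ * n) ↦ T u ≠ 0), cnt u ≤ R := by
      have hfib : ∑ u : ZMod (p₀ * n), cnt u = #I := by
        rw [hI, Finset.card_eq_sum_ones, ← Finset.sum_fiberwise_of_maps_to (t := univ)
          (g := fun i : Fin R ↦ ((((α i).val / (m / (p₀ * n))) : ℕ) : ZMod (p₀ * n))) (fun i _ ↦ mem_univ _)]
        refine Finset.sum_congr rfl fun u _ ↦ ?_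
        rw [hcnt, Finset.sum_const, smul_eq_mul, mul_one, Finset.filter_filter]
      calc ∑ u ∈ univ.filter (fun u : ZMod (p₀ * n) ↦ T u ≠ 0), cnt u ≤ ∑ u : ZMod (p₀ * n), cnt u :=
            Finset.sum_le_sum_of_subset (filter_subset _ _)
        _ = #I := hfib
        _ ≤ R := (card_le_univ I).trans (by rw [Fintype.card_fin])
    have hge : ∀ u ∈ univ.filter (fun u : ZMod (p₀ * n) ↦ T u ≠ 0), 1 ≤ cnt u := by
      intro u hu
      rw [mem_filter] at hu
      have : cnt u ≠ 0 := fun h0 ↦ hu.2 (by simp only [hT, h0, Nat.cast_zero])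
      omega
    have hones : ∑ u ∈ univ.filter (fun u : ZMod (p₀ * n) ↦ T u ≠ 0), (1 : ℕ) = R := by
      rw [Finset.sum_const, smul_eq_mul, mul_one, hSR]
    have heq : ∀ u ∈ univ.filter (fun u : ZMod (p₀ * n) ↦ T u ≠ 0), cnt u = 1 := by
      have hle2 : ∑ u ∈ univ.filter (fun u : ZMod (p₀ * n) ↦ T u ≠ 0), cnt u ≤
          ∑ u ∈ univ.filter (fun u : ZMod (p₀ * n) ↦ T u ≠ 0), (1 : ℕ) := by rw [hones]; exact hsum
      have := (Finset.sum_eq_sum_iff_of_le hge).mp (le_antisymm (Finset.sum_le_sum hge) hle2)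
      exact fun u hu ↦ (this u hu).symm
    intro u
    by_cases hu : T u = 0
    · exact Or.inl hu
    · right
      have h1 := heq u (by rw [mem_filter]; exact ⟨mem_univ _, hu⟩)
      simp only [hT, h1, Nat.cast_one]
  rcases even_or_fibre_of_boundary hp₀ hp₀5 hp₀n hn5 hc T h01 hTu hTodd hroom with hev | ⟨b, hbu, hfib⟩
  · have heven := hev v
    simp only [hT, Nat.cast_inj] at heven
    exact heven
  -- the full fibre: every level-`M` entry has `n`-residue `b`
  exfalso
  have hsupp_eq : (univ.filter fun u : ZMod (p₀ * n) ↦ T u ≠ 0) =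
      (univ : Finset (ZMod p₀)ˣ).image fun y : (ZMod p₀)ˣ ↦ (ZMod.chineseRemainder hc).symm ((y : ZMod p₀), b) := by
    symm
    apply Finset.eq_of_subset_of_card_le
    · intro u hu
      obtain ⟨y, -, rfl⟩ := mem_image.mp hu
      rw [mem_filter]
      exact ⟨mem_univ _, by rw [hfib y]; exact one_ne_zero⟩
    · rw [hSR, Finset.card_image_of_injective, Finset.card_univ, ZMod.card_units_eq_totient,
        Nat.totient_prime hp₀, hp₀R]
      · rfl
      · intro y y' hyy
        have := congrArg (ZMod.chineseRemainder hc) hyy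
        simp only [RingEquiv.apply_symm_apply, Prod.mk.injEq] at this
        exact Units.ext this.1
  have hres : ∀ i : Fin R, m / m.gcd (α i).val = p₀ * n ∧
      ZMod.castHom (dvd_mul_left n p₀) (ZMod n) ((((α i).val / (m / (p₀ * n))) : ℕ) : ZMod (p₀ * n)) = b := by
    -- all `R` indices are of level `M` (the image has `R` points, so `#I = R`), and their unit parts lie on the fibre
    have hIcard : #I = R := by
      refine le_antisymm ((card_le_univ I).trans (by rw [Fintype.card_fin])) ?_
      calc R = #(univ.filter fun u : ZMod (p₀ * n) ↦ T u ≠ 0) := hSR.symm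
        _ = #(I.image fun i ↦ ((((α i).val / (m / (p₀ * n))) : ℕ) : ZMod (p₀ * n))) := by rw [hsupp_img]
        _ ≤ #I := card_image_le
    have hIuniv : I = univ := Finset.eq_univ_of_card I (by rw [hIcard, Fintype.card_fin])
    intro i
    have hiI : i ∈ I := hIuniv ▸ mem_univ i
    have hlev : m / m.gcd (α i).val = p₀ * n := (mem_filter.mp hiI).2
    refine ⟨hlev, ?_⟩
    have hmem : ((((α i).val / (m / (p₀ * n))) : ℕ) : ZMod (p₀ * n)) ∈ univ.filter fun u : ZMod (p₀ * n) ↦ T u ≠ 0 := by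
      rw [hsupp_img]
      exact mem_image_of_mem _ hiI
    rw [hsupp_eq] at hmem
    obtain ⟨y, -, hy⟩ := mem_image.mp hmem
    rw [← hy, (castHom_crt_symm hc _ b).2]
  -- Aoki's criterion at `f = n`: `χ(p₀) = 1` for every odd primitive `χ` mod `n`
  have hnm : n ∣ m := (dvd_mul_left n p₀).trans hMm
  have hall : ∀ χ : DirichletCharacter ℂ n, χ.Odd → χ.IsPrimitive → χ ((p₀ : ℕ) : ZMod n) = 1 := by
    intro χ hχ hprim
    have key := h.aoki_criterion hnm hχ hprim (fun i ↦ m / m.gcd (α i).val) (fun i ↦ level_dvd (α i))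
      (fun i ↦ ((((α i).val / (m / (m / m.gcd (α i).val)) : ℕ) : ZMod (m / m.gcd (α i).val))))
      (fun i ↦ (hspec i).1) (fun i ↦ (hspec i).2.symm)
    have hcastn : ∀ (L : ℕ) (_ : L = p₀ * n) (y : ZMod m),
        (ZMod.cast ((((y.val / (m / L)) : ℕ) : ZMod L)) : ZMod n) =
          ZMod.castHom (dvd_mul_left n p₀) (ZMod n) ((((y.val / (m / (p₀ * n))) : ℕ) : ZMod (p₀ * n))) := by
      intro L hL y; subst hL; rfl
    have hprod : (∏ p ∈ (p₀ * n).primeFactors, (1 - χ p)) = 1 - χ ((p₀ : ℕ) : ZMod n) := by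
      rw [Nat.primeFactors_mul hp₀.ne_zero hn0, hp₀.primeFactors, Finset.prod_union, Finset.prod_singleton]
      · have hone : (∏ p ∈ n.primeFactors, (1 - χ p)) = 1 := by
          refine Finset.prod_eq_one fun p hp ↦ ?_
          have hnu : ¬ IsUnit ((p : ℕ) : ZMod n) := by
            rw [ZMod.isUnit_iff_coprime]
            exact fun hc' ↦ (Nat.prime_of_mem_primeFactors hp).one_lt.ne'
              (Nat.Coprime.eq_one_of_dvd hc' (Nat.dvd_of_mem_primeFactors hp))
          rw [χ.map_nonunit hnu, sub_zero]
        rw [hone, mul_one]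
      · rw [Finset.disjoint_singleton_left]
        exact fun hmem ↦ hp₀n (Nat.dvd_of_mem_primeFactors hmem)
    have hterm : ∀ i : Fin R, (if n ∣ m / m.gcd (α i).val then
        ((m.totient : ℂ) / ((m / m.gcd (α i).val).totient : ℂ)) *
          (∏ p ∈ (m / m.gcd (α i).val).primeFactors, (1 - χ p)) *
          (χ (ZMod.cast ((((α i).val / (m / (m / m.gcd (α i).val))) : ℕ) : ZMod (m / m.gcd (α i).val)) : ZMod n))⁻¹
        else 0) =
        ((m.totient : ℂ) / ((p₀ * n).totient : ℂ)) * (1 - χ ((p₀ : ℕ) : ZMod n)) * (χ b)⁻¹ := by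
      intro i
      obtain ⟨hlev, hb⟩ := hres i
      rw [hcastn _ hlev (α i), hb, if_pos (hlev ▸ dvd_mul_left n p₀), hlev, hprod]
    rw [Finset.sum_congr rfl fun i _ ↦ hterm i, Finset.sum_const, Finset.card_univ, Fintype.card_fin,
      nsmul_eq_mul] at key
    have hRne : (R : ℂ) ≠ 0 := by exact_mod_cast (show R ≠ 0 by omega)
    have hc₀ : (m.totient : ℂ) / ((p₀ * n).totient : ℂ) ≠ 0 :=
      div_ne_zero (by exact_mod_cast (Nat.totient_pos.mpr (NeZero.pos m)).ne')
        (by exact_mod_cast (Nat.totient_pos.mpr (NeZero.pos (p₀ * n))).ne')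
    have hχb0 : χ b ≠ 0 := by
      rw [← hbu.unit_spec]
      intro h0
      have := DirichletCharacter.unit_norm_eq_one χ hbu.unit
      rw [h0, norm_zero] at this
      exact zero_ne_one this
    have hχb : (χ b)⁻¹ ≠ 0 := inv_ne_zero hχb0
    rcases mul_eq_zero.mp key with h0 | h0
    · exact (hRne h0).elim
    · rcases mul_eq_zero.mp h0 with h0 | h0
      · rcases mul_eq_zero.mp h0 with h0 | h0
        · exact (hc₀ h0).elim
        · exact (sub_eq_zero.mp h0).symm
      · exact (hχb h0).elim
  have hnodd : Odd n := by
    rw [Nat.odd_iff]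
    by_contra h2
    have h2n : 2 ∣ n := Nat.dvd_of_mod_eq_zero (by omega)
    have := hn5 2 (Nat.mem_primeFactors.mpr ⟨Nat.prime_two, h2n, hn0⟩)
    omega
  obtain ⟨χ, hχo, hχp, hχne⟩ := exists_odd_isPrimitive_apply_natCast_ne_one (n := n) hp₀.two_le hn1 hnodd hnbig hc
  exact hχne (hall χ hχo hχp)

/-- **Hodge characters are paired when every prime factor of the level exceeds the length — the
sharp theorem.** For a Hodge character `α : Fin R → ℤ/m` with `R < p` for every prime `p ∣ m`
there is a fixed-point-free involution `σ` of `Fin R` with `α (σ i) = -α i`. For `R = n + 2` (the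
characters of the Fermat variety `Xⁿₘ`) the hypothesis is Aoki's `p > n + 1`: this is the
`𝔅ⁿₘ = 𝔇ⁿₘ` direction of [Aoki1983, Thm. A] (for `m` prime: Ran's Prop. 1.8 (i)).
[cite: Aoki1983, Thm. A] -/
theorem isPaired_of_primeFactors_gt_sharp : ∀ {R m : ℕ} [NeZero m] {α : Fin R → ZMod m}, IsHodge α → (∀ p ∈ m.primeFactors, R < p) → IsPaired α := by
  intro R m _ α h hR
  classical
  have hm0 : m ≠ 0 := NeZero.ne m
  rcases Nat.lt_or_ge R 4 with hR4 | hR4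
  · have hev : Even R := h.even
    match R, α, h, hev with
    | 0, α, _, _ => exact ⟨Equiv.refl _, fun i ↦ i.elim0, fun i ↦ i.elim0, fun i ↦ i.elim0⟩
    | 1, _, _, hev => exact absurd hev (by decide)
    | 2, α, h, _ =>
      have hsum := h.1.2
      rw [Fin.sum_univ_two] at hsum
      refine ⟨Equiv.swap 0 1, fun i ↦ ?_, fun i ↦ ?_, fun i ↦ ?_⟩
      · fin_cases i <;> simp
      · rw [Equiv.swap_apply_self]
      · fin_cases i
        · simp only [Fin.zero_eta, Fin.isValue, Equiv.swap_apply_left]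
          linear_combination hsum
        · simp only [Fin.mk_one, Fin.isValue, Equiv.swap_apply_right]
          linear_combination hsum
    | 3, _, _, hev => exact absurd hev (by decide)
    | R' + 4, _, _, _ => omega
  -- `m` is odd, so no entry equals its own negative
  have hmodd : ¬ 2 ∣ m := by
    intro h2
    have := hR 2 (Nat.mem_primeFactors.mpr ⟨Nat.prime_two, h2, hm0⟩)
    omega
  have hne : ∀ i, α i ≠ -α i := by
    intro i hi
    have h2 : (2 : ZMod m) * α i = 0 := by rw [two_mul]; nth_rewrite 2 [hi]; exact add_neg_cancel _
    have h2u : IsUnit (2 : ZMod m) := by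
      rw [show (2 : ZMod m) = ((2 : ℕ) : ZMod m) by norm_cast, ZMod.isUnit_iff_coprime]
      exact (Nat.coprime_two_left).mpr (Nat.odd_iff.mpr (Nat.two_dvd_ne_zero.mp hmodd))
    exact h.1.1 i ((h2u.mul_right_eq_zero).mp h2)
  refine isPaired_of_card_filter_eq hne fun x ↦ ?_
  by_cases hx : x = 0
  · rw [hx, neg_zero]
  set M := m / m.gcd x.val with hM
  have hMm : M ∣ m := level_dvd x
  have hfibre : ∀ y : ZMod m, m / m.gcd y.val = M →
      (univ.filter fun i : Fin R ↦ α i = y) =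
        univ.filter fun i : Fin R ↦ m / m.gcd (α i).val = M ∧
          ((((α i).val / (m / M)) : ℕ) : ZMod M) = (((y.val / (m / M)) : ℕ) : ZMod M) := by
    intro y hy
    ext i
    simp only [mem_filter, mem_univ, true_and]
    constructor
    · rintro rfl; exact ⟨hy, rfl⟩
    · rintro ⟨hli, hri⟩
      exact eq_of_level_eq_of_unitPart_eq hli hy hri
  rw [hfibre x rfl, hfibre (-x) (by rw [level_neg]), unitPart_neg hx hM.symm]
  exact (level_count_even_sharp h hR4 hR (m / M) M hMm rfl _).symm

end Sharp

end PairedNull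

end Summit.HodgeConjecture.HodgeConjecture.Theorems.CancelByAnyClaimLattice

end
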